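/-
Fleet lead `ym-wcr-19609-p1` (seat prover-ym-wcr-19609-p1-g2-0), route `WeakCouplingRates`, crux `BulkDominatesColdBoxW`
(stmt-QuantumFields-19609), line `dlr-chessboard` (v6): the MEAN SHIFT is small on every plaquette touching the box (input of the good-event sandwich H-T5).
-/
import Summits.QuantumFields.YangMills.Theorems.WeakCouplingRatesBulkDominatesColdBoxWSmallLinksDatum
import Summits.QuantumFields.YangMills.Theorems.WeakCouplingRatesBulkDominatesColdBoxWDatumCompetitorEventually
import Summits.QuantumFields.YangMills.Theorems.WeakCouplingRatesColdBoxDirichletForm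
import Summits.QuantumFields.YangMills.Theorems.WeakCouplingRatesColdBoxTwoPointFloorWStubBoxKernelVsLattice

/-!
# Crux `BulkDominatesColdBoxW`, expansion stubs: the background circulation (the Gaussian MEAN SHIFT) is uniformly small on the plaquettes touching
# the cold box, from the ENERGY clause alone

Critic's STUB-PLAN (evidence #30) H-T5 / trap T-b: the good-event sandwich of the assembly with datum must use CIRCULATION sizes of the background
`F̄_c(p) = sCirc (glue ϑ_c (mean ϑ_c)) p` only.  From the energy clause of `KernelMeanExpansion` / `KernelCovExpansion`
(`Σ_c M_{ϑ_c}(s_c) ≤ 16(2H+3)⁴β^{2δ−1}`, delivered by `exists_datum_coords_energy_eventually`) and `F̄_c(p)² ≤ M_{ϑ_c}(s_c)` for ANY competitor `s_c`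
(`dirBackground_sq_le_formM`):
* `dirBackground_touching_sq_le_formM` — the same bound for a plaquette touching the cold box, in `ZdPlaquette` form;
* `sqrt_two_beta_mul_abs_dirBackground_le` — `√(2β)·|F̄_c(p)| ≤ √(2β·B)` whenever `Σ_c M_{ϑ_c}(s_c) ≤ B`;
* `dirBackground_shift_small_eventually` — for `2θ + δ < ε`: eventually in `β`, the energy clause implies `√(2β)·|F̄_c(p)| ≤ β^{ε}/4` for every
  plaquette touching the box and every colour (so the shifted Gaussian good event `{|√(2β)F̄ + X| ≤ β^ε/2}` contains `{|X| ≤ β^ε/4}`).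
No new definition; standard axioms.  NOT a claim about the mass gap.
-/

set_option autoImplicit false

noncomputable section

open Finset
open Literature.Probability.LatticeModels Literature.MathematicalPhysics.QuantumLattice
open Literature.MathematicalPhysics.QuantumFieldTheory Literature.MathematicalPhysics.QuantumFieldTheory.AxialGauge
open Literature.MathematicalPhysics.QuantumFieldTheory.LatticeMaxwell

namespace Summit.QuantumFields.YangMills.Theorems.WeakCouplingRates

/-- `F̄(p)² ≤ M_ϑ(s)` for a plaquette touching the cold box (any competitor `s`). -/
theorem dirBackground_touching_sq_le_formM (H : ℕ) (ϑ : Literature.MathematicalPhysics.QuantumLattice.ZdEdge 4 → ℝ) (s : DirFree H → ℝ)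
    {p : ZdPlaquette 4} (hp : p ∈ plaquettesTouching (boxEdges 4 (2 * H + 1))) :
    sCirc (LatticeMaxwell.glue (pin := fun e => e ∉ dirFreeEdges H) dirCorner (2 * H + 3) ϑ
        (mean (fun e => e ∉ dirFreeEdges H) dirCorner (2 * H + 3) ϑ)) (p.1, p.2.1.1, p.2.1.2) ^ 2 ≤
      formM (fun e => e ∉ dirFreeEdges H) dirCorner (2 * H + 3) ϑ s := by
  have h := dirBackground_sq_le_formM H ϑ s (unshift_mem_plaquettesIn hp)
  have hs : Plaq.shift dirCorner ((p.1 - dirCorner, p.2.1.1, p.2.1.2) : Plaq 4) = (p.1, p.2.1.1, p.2.1.2) := by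
    simp [Plaq.shift]
  rwa [hs] at h

/-- `√(2β)·|F̄_c(p)| ≤ √(2β·B)` from the three-colour energy bound `Σ_c M_{ϑ_c}(s_c) ≤ B`. -/
theorem sqrt_two_beta_mul_abs_dirBackground_le (H : ℕ) {β B : ℝ} (hβ : 0 ≤ β)
    (ϑ : Fin 3 → Literature.MathematicalPhysics.QuantumLattice.ZdEdge 4 → ℝ) (s : Fin 3 → DirFree H → ℝ)
    (hE : ∑ c, formM (fun e => e ∉ dirFreeEdges H) dirCorner (2 * H + 3) (ϑ c) (s c) ≤ B)
    {p : ZdPlaquette 4} (hp : p ∈ plaquettesTouching (boxEdges 4 (2 * H + 1))) (c : Fin 3) :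
    Real.sqrt (2 * β) * |sCirc (LatticeMaxwell.glue (pin := fun e => e ∉ dirFreeEdges H) dirCorner (2 * H + 3) (ϑ c)
        (mean (fun e => e ∉ dirFreeEdges H) dirCorner (2 * H + 3) (ϑ c))) (p.1, p.2.1.1, p.2.1.2)| ≤ Real.sqrt (2 * β * B) := by
  set F : ℝ := sCirc (LatticeMaxwell.glue (pin := fun e => e ∉ dirFreeEdges H) dirCorner (2 * H + 3) (ϑ c)
        (mean (fun e => e ∉ dirFreeEdges H) dirCorner (2 * H + 3) (ϑ c))) (p.1, p.2.1.1, p.2.1.2) with hF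
  have h1 : F ^ 2 ≤ formM (fun e => e ∉ dirFreeEdges H) dirCorner (2 * H + 3) (ϑ c) (s c) :=
    dirBackground_touching_sq_le_formM H (ϑ c) (s c) hp
  have h2 : formM (fun e => e ∉ dirFreeEdges H) dirCorner (2 * H + 3) (ϑ c) (s c) ≤
      ∑ c', formM (fun e => e ∉ dirFreeEdges H) dirCorner (2 * H + 3) (ϑ c') (s c') :=
    Finset.single_le_sum (f := fun c' => formM (fun e => e ∉ dirFreeEdges H) dirCorner (2 * H + 3) (ϑ c') (s c'))
      (fun c' _ => formM_nonneg _ _) (Finset.mem_univ c)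
  have hFB : F ^ 2 ≤ B := h1.trans (h2.trans hE)
  have habs : |F| ≤ Real.sqrt B := by
    rw [← Real.sqrt_sq_eq_abs]; exact Real.sqrt_le_sqrt hFB
  calc Real.sqrt (2 * β) * |F| ≤ Real.sqrt (2 * β) * Real.sqrt B := by gcongr
    _ = Real.sqrt (2 * β * B) := by rw [← Real.sqrt_mul (by positivity)]

/-- **The mean shift is eventually below a quarter of the small-field threshold.**  For `0 < θ` and `2θ + δ < ε` there is `β₀` such that for
`β ≥ β₀`, `H = ⌈β^θ⌉`, every datum triple `ϑ` and competitors `s` with `Σ_c M_{ϑ_c}(s_c) ≤ 16(2H+3)⁴β^{2δ−1}`, every plaquette `p` touching the cold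
box and every colour: `√(2β)·|F̄_c(p)| ≤ β^{ε}/4`. -/
theorem dirBackground_shift_small_eventually {θ δ ε : ℝ} (hθ : 0 < θ) (hε : 2 * θ + δ < ε) :
    ∃ β₀ : ℝ, ∀ β : ℝ, β₀ ≤ β → ∀ (ϑ : Fin 3 → Literature.MathematicalPhysics.QuantumLattice.ZdEdge 4 → ℝ) (s : Fin 3 → DirFree ⌈β ^ θ⌉₊ → ℝ),
      ∑ c, formM (fun e => e ∉ dirFreeEdges ⌈β ^ θ⌉₊) dirCorner (2 * ⌈β ^ θ⌉₊ + 3) (ϑ c) (s c) ≤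
          16 * (2 * (⌈β ^ θ⌉₊ : ℝ) + 3) ^ 4 * β ^ (2 * δ - 1) →
        ∀ p ∈ plaquettesTouching (boxEdges 4 (2 * ⌈β ^ θ⌉₊ + 1)), ∀ c : Fin 3,
          Real.sqrt (2 * β) * |sCirc (LatticeMaxwell.glue (pin := fun e => e ∉ dirFreeEdges ⌈β ^ θ⌉₊) dirCorner (2 * ⌈β ^ θ⌉₊ + 3) (ϑ c)
              (mean (fun e => e ∉ dirFreeEdges ⌈β ^ θ⌉₊) dirCorner (2 * ⌈β ^ θ⌉₊ + 3) (ϑ c))) (p.1, p.2.1.1, p.2.1.2)| ≤ β ^ ε / 4 := by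
  have hgap : 0 < ε - 2 * θ - δ := by linarith only [hε]
  refine ⟨max 1 ((1120 : ℝ) ^ (1 / (ε - 2 * θ - δ))), fun β hβ ϑ s hE p hp c => ?_⟩
  have hβ1 : (1 : ℝ) ≤ β := le_trans (le_max_left _ _) hβ
  have hβ0 : 0 < β := by linarith only [hβ1]
  have hT : 1120 ≤ β ^ (ε - 2 * θ - δ) := le_rpow_of_root_le (by norm_num) hgap (le_trans (le_max_right _ _) hβ)
  have h0 := sqrt_two_beta_mul_abs_dirBackground_le ⌈β ^ θ⌉₊ hβ0.le ϑ s hE hp c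
  refine h0.trans ?_
  clear h0 hE hp
  obtain ⟨-, hH2⟩ := one_le_ceil_rpow_and_le hβ1 hθ.le
  -- `√(2β·16(2H+3)⁴β^{2δ−1}) = 4√2 (2H+3)² β^δ ≤ 280 β^{2θ+δ} ≤ β^ε/4`
  obtain ⟨X, hX⟩ : ∃ X : ℝ, X = (⌈β ^ θ⌉₊ : ℝ) := ⟨_, rfl⟩
  rw [← hX] at hH2 ⊢
  have hX0 : 0 ≤ X := by rw [hX]; positivity
  have hHθ : 2 * X + 3 ≤ 7 * β ^ θ := by
    have : (1 : ℝ) ≤ β ^ θ := Real.one_le_rpow hβ1 hθ.le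
    linarith only [this, hH2]
  have hsq : (2 * X + 3) ^ 2 ≤ 49 * β ^ (2 * θ) := by
    have h := pow_le_pow_left₀ (by linarith only [hX0] : (0 : ℝ) ≤ 2 * X + 3) hHθ 2
    have e : (7 * β ^ θ) ^ 2 = 49 * β ^ (2 * θ) := by
      rw [mul_pow, show (2 : ℝ) * θ = θ * ((2 : ℕ) : ℝ) by push_cast; ring, Real.rpow_mul_natCast hβ0.le]; norm_num
    rwa [e] at h
  have hδpos : 0 ≤ β ^ δ := Real.rpow_nonneg hβ0.le _
  have h2θpos : 0 ≤ β ^ (2 * θ) := Real.rpow_nonneg hβ0.le _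
  have hinside : 2 * β * (16 * (2 * X + 3) ^ 4 * β ^ (2 * δ - 1)) = (4 * (2 * X + 3) ^ 2 * β ^ δ) ^ 2 * 2 := by
    have e1 : β * β ^ (2 * δ - 1) = (β ^ δ) ^ 2 := by
      rw [show (β ^ δ) ^ 2 = β ^ (2 * δ) by
        rw [show (2 : ℝ) * δ = δ * ((2 : ℕ) : ℝ) by push_cast; ring, Real.rpow_mul_natCast hβ0.le]]
      rw [show β * β ^ (2 * δ - 1) = β ^ (1 : ℝ) * β ^ (2 * δ - 1) by rw [Real.rpow_one], ← Real.rpow_add hβ0]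
      ring_nf
    linear_combination (32 * (2 * X + 3) ^ 4) * e1
  have hs2 : Real.sqrt 2 ≤ 71 / 50 := by rw [Real.sqrt_le_left (by norm_num)]; norm_num
  have hY0 : 0 ≤ 4 * (2 * X + 3) ^ 2 * β ^ δ := by positivity
  have hsqrt : Real.sqrt (2 * β * (16 * (2 * X + 3) ^ 4 * β ^ (2 * δ - 1))) = 4 * (2 * X + 3) ^ 2 * β ^ δ * Real.sqrt 2 := by
    rw [hinside, Real.sqrt_mul (by positivity), Real.sqrt_sq hY0]
  rw [hsqrt]
  have hXD : 0 ≤ β ^ (2 * θ) * β ^ δ := mul_nonneg h2θpos hδpos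
  have hstep : 4 * (2 * X + 3) ^ 2 * β ^ δ * Real.sqrt 2 ≤ 280 * (β ^ (2 * θ) * β ^ δ) := by
    calc 4 * (2 * X + 3) ^ 2 * β ^ δ * Real.sqrt 2 ≤ 4 * (49 * β ^ (2 * θ)) * β ^ δ * (71 / 50) := by gcongr
      _ ≤ 280 * (β ^ (2 * θ) * β ^ δ) := by linarith only [hXD]
  refine hstep.trans ?_
  -- `280 β^{2θ+δ} ≤ β^ε / 4` iff `1120 ≤ β^{ε−2θ−δ}`
  have hprod : β ^ (2 * θ) * β ^ δ * β ^ (ε - 2 * θ - δ) = β ^ ε := by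
    rw [← Real.rpow_add hβ0, ← Real.rpow_add hβ0]; ring_nf
  have h := mul_le_mul_of_nonneg_left hT hXD
  rw [hprod] at h
  linarith only [h]

end Summit.QuantumFields.YangMills.Theorems.WeakCouplingRates

end
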